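import Summits.HubbardSuperconductivity.HubbardSuperconductivity.Theses.ParityGapRigidity
import Summits.HubbardSuperconductivity.HubbardSuperconductivity.Theses.AnomalyExhaustion
import Literature.MathematicalPhysics.QuantumLattice.MomentumDistributionLipschitz
import HarnessLib

/-!
# Route ParityGapRigidity — crux `IncommensurateRigidity` (stmt-HubbardSuperconductivity-2195):
# the bridge from the filed named conjecture `AnomalyExhaustion.EtsTrichotomy` (stmt-1458)

Helper file (`--supports stmt-HubbardSuperconductivity-2195`, line `registered`, lead c9).

The crux R (`ParityGapRigidity.IncommensurateRigidity`) is a converse Lieb–Schultz–Mattis bet: at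
non-integer filling, (H1) exponentially decaying `ρ₁`, (H2) normal range-`≤ 1` one-body fluctuations,
(H3) at most `D` in-sector levels below `E₀ + c/L`, (H4) a soft pair staircase, uniformly in even `L`,
imply UNIFORM Yang ODLRO `a·L² ≤ Re v†ρ₂(ψ)v` of every sector ground state. The programme ALREADY
carries a named conjecture of exactly this flavour as a typed, refutable item: the Hubbard
Else–Thorngren–Senthil trichotomy `AnomalyExhaustion.EtsTrichotomy` (stmt-HubbardSuperconductivity-1458):
at IRRATIONAL doping every family of normalised `(N_L, 0)`-sector ground states along strictly increasing
even sides has (A) a pair condensate `c·L² ≤ λ_max(ρ₂)` frequently, or (B) a finite-range particle–hole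
density wave `c·L⁴ ≤ ⟨D_q† D_q⟩` frequently, or (C) an arc of quasiparticle discontinuities of `n_σ(k)`.

This file machine-checks what the bridge `EtsTrichotomy ⟹ (conclusion of R)` consumes:

* `not_fermiArc_of_clustering` — branch (C) is impossible for ANY family of states whose one-particle
  density matrix clusters exponentially with `L`-uniform constants (the crux's (H1)): by the tree's
  `abs_re_expect_momentumNumber_sub_le_of_clustering` the occupation `n_σ(k)` is `L`-uniformly Lipschitz
  in `k` with constant `O(1/L)`, so two continuum momenta within `ε` of a point of the arc carry
  occupations within `16 C S_m ε + 16π C S_m / L < Z` — no jump `Z` survives. (Reusable by route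
  AnomalyExhaustion: with the tree's `ParityGapClustering` it turns a uniform parity gap into ¬(C).)
* `yangODLRO_of_etsTrichotomy` — **the bridge**: `EtsTrichotomy`, `U > 0`, `δ ∈ (0,1/2)` IRRATIONAL,
  the crux's (H1) verbatim, and ONE further clause — finite-range structure factors are `o(L⁴)` uniformly
  over sector ground states (`∀ R a c>0, ∃ L₀, ∀ even L ≥ L₀, ∀ ψ, ∀ q ≠ 0, Re⟨D_q†D_q⟩_ψ ≤ c L⁴`, the
  pointwise form of `AnomalyExhaustion.NoDensityWave`'s clause) — give the crux's conclusion AT `(U, δ)`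
  verbatim (one `a > 0` for every sector ground state at every large even `L`). Proof: were the uniform
  conclusion false, diagonal extraction (`Filter.extraction_forall_of_frequently`) gives strictly
  increasing even sides `φ j + 1` with normalised sector ground states of `λ_max(ρ₂) ≤ L²/(j+1)`; the
  trichotomy applied to that family: (A) contradicts the construction, (B) the structure-factor clause,
  (C) `not_fermiArc_of_clustering`.
* `yangODLRO_of_etsTrichotomy_of_bounded` — the same with the `R`-style clause `Re⟨D_q†D_q⟩_ψ ≤ C_{R,a}·L²`
  (bounded structure factors, no Bragg peak).

What this shows for the planner (see `Cruxes/IncommensurateRigidity/Lines/registered-dead-c9.md`):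
(H3) and (H4) are idle in this reading, and R restated with `Irrational δ` and (H2) read as a
finite-range structure-factor bound closes TODAY as a checked composition over the existing conjecture
item stmt-1458; stmt-1458 AS TYPED does not give R AS TYPED (R also claims rational `δ`; (B) ranges over
every finite range `R ⊂ ℤ²` while (H2) is range `≤ 1` and variance-only).

No definitions; nothing is vendored. Sources: Else–Thorngren–Senthil, Phys. Rev. X 11 (2021) 021005,
Thm 1 (the trichotomy = stmt-1458, a HYPOTHESIS here); Yang, Rev. Mod. Phys. 34 (1962) 694, §4; Migdal,
Sov. Phys. JETP 5 (1957) 333 (a gap smooths `n(k)`) — all statements below are folklore soft analysis.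
-/

noncomputable section

namespace Summit.HubbardSuperconductivity.IncommensurateRigidity.Birth

open scoped BigOperators Matrix ComplexConjugate
open Matrix Filter Topology Literature.MathematicalPhysics.QuantumLattice Literature.Probability.LatticeModels

/-! ### The momentum occupation of the trichotomy is the tree's `⟨n_{kσ}⟩` -/

/-- The occupation functional of `EtsTrichotomy` / `NoFermiArc`,
`L⁻² Re Σ_{x,y} χ_k(x) conj χ_k(y) ⟨ψ, c†_{xσ} c_{yσ} ψ⟩` (sites of `(ℤ/Lℤ)²`), is the real part of the
expectation of the tree's Bloch-mode number operator `momentumNumber k σ`. [folklore] -/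
theorem nocc_eq_re_expect_momentumNumber {L : ℕ} [NeZero L] (k : TorusSite 2 L) (σ : Fin 2)
    (ψ : Fock (Orb (FermionTorus 2 L))) :
    (∑ x : TorusSite 2 L, ∑ y : TorusSite 2 L, torusChar k x * conj (torusChar k y) *
        expect (creation (orb (FermionTorus.ofTorusSite x) σ) *
          annihilation (orb (FermionTorus.ofTorusSite y) σ)) ψ).re / (L : ℝ) ^ 2 =
      (expect (momentumNumber k σ) ψ).re := by
  rw [expect_momentumNumber_eq_sum]
  have hre : ∀ (x y : FermionTorus 2 L),
      torusFourierWeight 2 L * torusFourierWeight 2 L *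
            torusChar k (x.toTorusSite - y.toTorusSite) * oneParticleRDM ψ (orb x σ) (orb y σ) =
        (((L : ℝ) ^ 2)⁻¹ : ℝ) * (torusChar k x.toTorusSite * conj (torusChar k y.toTorusSite) *
          expect (creation (orb x σ) * annihilation (orb y σ)) ψ) := by
    intro x y
    rw [torusFourierWeight_mul_self, torusChar_sub_right, oneParticleRDM_apply]
    push_cast
    ring
  simp_rw [hre, ← Finset.mul_sum, Complex.re_ofReal_mul]
  rw [div_eq_inv_mul]
  congr 2
  -- reindex the fermionic torus by the statistical-mechanics torus
  rw [← Equiv.sum_comp FermionTorus.equivTorusSite.symm]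
  refine Finset.sum_congr rfl fun x _ => ?_
  rw [← Equiv.sum_comp FermionTorus.equivTorusSite.symm]
  refine Finset.sum_congr rfl fun y _ => ?_
  simp [FermionTorus.equivTorusSite]

/-! ### Floors: the trichotomy's grid momentum is Lipschitz in the continuum momentum -/

/-- The grid momentum `k(p) = (⌊p_i L / 2π⌋ mod L)_i` of `EtsTrichotomy`: two continuum momenta at
sup-distance `dist p p'` have grid momenta at torus distance `≤ dist p p' · L/(2π) + 1`. [folklore] -/
theorem torusDist_gridMomentum_le {L : ℕ} [NeZero L] (p p' : Fin 2 → ℝ) :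
    (torusDist (fun i => (((⌊p i * (L : ℝ) / (2 * Real.pi)⌋ : ℤ) : ZMod L)))
        (fun i => (((⌊p' i * (L : ℝ) / (2 * Real.pi)⌋ : ℤ) : ZMod L))) : ℝ) ≤
      dist p p' * (L : ℝ) / (2 * Real.pi) + 1 := by
  set k : TorusSite 2 L := fun i => (((⌊p i * (L : ℝ) / (2 * Real.pi)⌋ : ℤ) : ZMod L)) with hk
  set k' : TorusSite 2 L := fun i => (((⌊p' i * (L : ℝ) / (2 * Real.pi)⌋ : ℤ) : ZMod L)) with hk'
  -- the torus distance is attained at some coordinate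
  obtain ⟨i, -, hi⟩ := Finset.exists_mem_eq_sup (Finset.univ : Finset (Fin 2)) Finset.univ_nonempty
    (fun i => min ((k - k') i).val (L - ((k - k') i).val))
  have hdist : torusDist k k' = min ((k - k') i).val (L - ((k - k') i).val) := hi
  set n : ℤ := ⌊p i * (L : ℝ) / (2 * Real.pi)⌋ - ⌊p' i * (L : ℝ) / (2 * Real.pi)⌋ with hn
  have hki : (k - k') i = (n : ZMod L) := by
    simp [hk, hk', hn]
  -- the cyclic absolute value of an integer class is at most the integer's absolute value
  have hmin : min ((k - k') i).val (L - ((k - k') i).val) ≤ n.natAbs := by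
    rw [← ZMod.valMinAbs_natAbs_eq_min, hki]
    exact ZMod.natAbs_min_of_le_div_two L _ _ (by rw [ZMod.coe_valMinAbs])
      (ZMod.natAbs_valMinAbs_le _)
  have hpi : 0 < 2 * Real.pi := by positivity
  have hfloor : ((n.natAbs : ℕ) : ℝ) ≤ dist p p' * (L : ℝ) / (2 * Real.pi) + 1 := by
    have hcast : ((n.natAbs : ℕ) : ℝ) = |(n : ℝ)| := by
      rw [Nat.cast_natAbs, Int.cast_abs]
    rw [hcast, hn]
    push_cast
    have h1 := Int.floor_le (p i * (L : ℝ) / (2 * Real.pi))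
    have h2 := Int.lt_floor_add_one (p i * (L : ℝ) / (2 * Real.pi))
    have h3 := Int.floor_le (p' i * (L : ℝ) / (2 * Real.pi))
    have h4 := Int.lt_floor_add_one (p' i * (L : ℝ) / (2 * Real.pi))
    have hcoord : |p i - p' i| ≤ dist p p' := by
      rw [← Real.dist_eq]
      exact dist_le_pi_dist p p' i
    have hL : (0 : ℝ) ≤ (L : ℝ) := Nat.cast_nonneg L
    have hdiff : |p i * (L : ℝ) / (2 * Real.pi) - p' i * (L : ℝ) / (2 * Real.pi)| ≤
        dist p p' * (L : ℝ) / (2 * Real.pi) := by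
      rw [← sub_div, ← sub_mul, abs_div, abs_mul, abs_of_pos hpi, abs_of_nonneg hL]
      gcongr
    rw [abs_le]
    rw [abs_le] at hdiff
    constructor <;> linarith [hdiff.1, hdiff.2]
  calc (torusDist k k' : ℝ) = ((min ((k - k') i).val (L - ((k - k') i).val) : ℕ) : ℝ) := by
        rw [hdist]
    _ ≤ ((n.natAbs : ℕ) : ℝ) := by exact_mod_cast hmin
    _ ≤ _ := hfloor

/-! ### Branch (C) of the trichotomy is impossible under clustering of `ρ₁` -/

/-- **No Fermi arc under exponential clustering of the one-particle density matrix.** For any family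
of Fock vectors `ψ_j` on the tori `(ℤ/(M j + 1)ℤ)²` with `M` strictly increasing, if eventually in `j`
`‖ρ₁(ψ_j)((x,σ),(y,σ))‖ ≤ C e^{-m·dist(x,y)}` for all sites and spins (one pair of constants `C`,
`m > 0` for the whole family — the crux's (H1)), then the family carries NO arc of quasiparticle
discontinuities in the sense of `AnomalyExhaustion.NoFermiArc` / branch (C) of `EtsTrichotomy`: the
occupation `n_j(σ, p) = L⁻² Re Σ_{x,y} χ_{k(p)}(x) conj χ_{k(p)}(y) ⟨c†_{xσ} c_{yσ}⟩` is `L`-uniformly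
Lipschitz in `p` up to `O(1/L)` (`abs_re_expect_momentumNumber_sub_le_of_clustering`,
`torusDist_gridMomentum_le`), so no jump `Z > 0` between `ε`-close momenta persists. [folklore] -/
theorem not_fermiArc_of_clustering :
    ∀ (M : ℕ → ℕ), StrictMono M → ∀ (ψ : ∀ j, Fock (Orb (FermionTorus 2 (M j + 1)))) (C m : ℝ),
    0 < m → (∀ᶠ j in atTop, ∀ (x y : FermionTorus 2 (M j + 1)) (σ : Fin 2),
      ‖oneParticleRDM (ψ j) (orb x σ) (orb y σ)‖ ≤
        C * Real.exp (-(m * (torusDist x.toTorusSite y.toTorusSite : ℝ)))) →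
    ¬ ∃ (σ : Fin 2) (Z : ℝ) (γ : ℝ → (Fin 2 → ℝ)), 0 < Z ∧ Continuous γ ∧ γ 0 ≠ γ 1 ∧
      ∀ t ∈ Set.Icc (0 : ℝ) 1, ∀ ε > (0 : ℝ), ∃ p p' : Fin 2 → ℝ, dist p (γ t) < ε ∧ dist p' (γ t) < ε ∧
        ∀ᶠ j in atTop,
          (∑ x : TorusSite 2 (M j + 1), ∑ y : TorusSite 2 (M j + 1),
              torusChar (fun i => (((⌊p' i * ((M j + 1 : ℕ) : ℝ) / (2 * Real.pi)⌋ : ℤ) :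
                ZMod (M j + 1)))) x *
              (starRingEnd ℂ) (torusChar (fun i => (((⌊p' i * ((M j + 1 : ℕ) : ℝ) /
                (2 * Real.pi)⌋ : ℤ) : ZMod (M j + 1)))) y) *
              expect (creation (orb (FermionTorus.ofTorusSite x) σ) *
                annihilation (orb (FermionTorus.ofTorusSite y) σ)) (ψ j)).re /
              ((M j + 1 : ℕ) : ℝ) ^ 2 + Z ≤
          (∑ x : TorusSite 2 (M j + 1), ∑ y : TorusSite 2 (M j + 1),
              torusChar (fun i => (((⌊p i * ((M j + 1 : ℕ) : ℝ) / (2 * Real.pi)⌋ : ℤ) :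
                ZMod (M j + 1)))) x *
              (starRingEnd ℂ) (torusChar (fun i => (((⌊p i * ((M j + 1 : ℕ) : ℝ) /
                (2 * Real.pi)⌋ : ℤ) : ZMod (M j + 1)))) y) *
              expect (creation (orb (FermionTorus.ofTorusSite x) σ) *
                annihilation (orb (FermionTorus.ofTorusSite y) σ)) (ψ j)).re /
              ((M j + 1 : ℕ) : ℝ) ^ 2 := by
  rintro M hM ψ C m hm hcl ⟨σ, Z, γ, hZ, -, -, harc⟩
  -- a nonnegative clustering constant
  set C' : ℝ := max C 0 with hC'
  have hC'0 : 0 ≤ C' := le_max_right _ _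
  set S : ℝ := ∑' r : ℕ, (2 * (r : ℝ) + 1) * ((r : ℝ) * Real.exp (-(m * r))) with hS
  have hS0 : 0 ≤ S := tsum_nonneg fun r => mul_nonneg (by positivity)
    (mul_nonneg (Nat.cast_nonneg r) (Real.exp_nonneg _))
  have hK0 : 0 ≤ 16 * C' * S := by positivity
  -- the momentum resolution `ε`
  set ε : ℝ := Z / (4 * (16 * C' * S + 1)) with hε
  have hε0 : 0 < ε := by positivity
  obtain ⟨p, p', hp, hp', hev⟩ := harc 0 (by simp) ε hε0
  have hpp : dist p p' < 2 * ε :=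
    calc dist p p' ≤ dist p (γ 0) + dist p' (γ 0) := dist_triangle_right _ _ _
      _ < ε + ε := add_lt_add hp hp'
      _ = 2 * ε := by ring
  -- the sides tend to infinity
  have hL : Tendsto (fun j => ((M j + 1 : ℕ) : ℝ)) atTop atTop :=
    tendsto_natCast_atTop_atTop.comp ((tendsto_add_atTop_nat 1).comp hM.tendsto_atTop)
  have hbig : ∀ᶠ j in atTop, 64 * Real.pi * C' * S / Z ≤ ((M j + 1 : ℕ) : ℝ) :=
    hL.eventually_ge_atTop _
  -- the Lipschitz estimate along the family, eventually
  have hlip : ∀ᶠ j in atTop,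
      (∑ x : TorusSite 2 (M j + 1), ∑ y : TorusSite 2 (M j + 1),
          torusChar (fun i => (((⌊p i * ((M j + 1 : ℕ) : ℝ) / (2 * Real.pi)⌋ : ℤ) :
            ZMod (M j + 1)))) x *
          (starRingEnd ℂ) (torusChar (fun i => (((⌊p i * ((M j + 1 : ℕ) : ℝ) /
            (2 * Real.pi)⌋ : ℤ) : ZMod (M j + 1)))) y) *
          expect (creation (orb (FermionTorus.ofTorusSite x) σ) *
            annihilation (orb (FermionTorus.ofTorusSite y) σ)) (ψ j)).re /
          ((M j + 1 : ℕ) : ℝ) ^ 2 -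
      (∑ x : TorusSite 2 (M j + 1), ∑ y : TorusSite 2 (M j + 1),
          torusChar (fun i => (((⌊p' i * ((M j + 1 : ℕ) : ℝ) / (2 * Real.pi)⌋ : ℤ) :
            ZMod (M j + 1)))) x *
          (starRingEnd ℂ) (torusChar (fun i => (((⌊p' i * ((M j + 1 : ℕ) : ℝ) /
            (2 * Real.pi)⌋ : ℤ) : ZMod (M j + 1)))) y) *
          expect (creation (orb (FermionTorus.ofTorusSite x) σ) *
            annihilation (orb (FermionTorus.ofTorusSite y) σ)) (ψ j)).re /
          ((M j + 1 : ℕ) : ℝ) ^ 2 ≤ Z / 2 := by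
    filter_upwards [hcl, hbig] with j hclj hbigj
    set L : ℕ := M j + 1 with hLdef
    set k : TorusSite 2 L := fun i => (((⌊p i * (L : ℝ) / (2 * Real.pi)⌋ : ℤ) : ZMod L)) with hk
    set k' : TorusSite 2 L := fun i => (((⌊p' i * (L : ℝ) / (2 * Real.pi)⌋ : ℤ) : ZMod L)) with hk'
    rw [nocc_eq_re_expect_momentumNumber k σ (ψ j), nocc_eq_re_expect_momentumNumber k' σ (ψ j)]
    have hLpos : (0 : ℝ) < (L : ℝ) := by rw [hLdef]; positivity
    -- clustering with the nonnegative constant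
    have hclj' : ∀ x y : FermionTorus 2 L, ‖oneParticleRDM (ψ j) (orb x σ) (orb y σ)‖ ≤
        C' * Real.exp (-(m * torusDist x.toTorusSite y.toTorusSite)) := fun x y =>
      (hclj x y σ).trans (mul_le_mul_of_nonneg_right (le_max_left _ _) (Real.exp_nonneg _))
    have hmain := abs_re_expect_momentumNumber_sub_le_of_clustering hC'0 hm σ (ψ j) hclj' k k'
    have hkk : (torusDist k k' : ℝ) ≤ dist p p' * (L : ℝ) / (2 * Real.pi) + 1 :=
      torusDist_gridMomentum_le p p'
    have hpi : 0 < Real.pi := Real.pi_pos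
    -- `16π C' S · dist(k,k')/L ≤ 16 C' S · (2ε)/(2) … ≤ Z/4 + Z/4`
    have hstep1 : 16 * Real.pi * C' * S * (torusDist k k' : ℝ) / (L : ℝ) ≤
        16 * Real.pi * C' * S * (dist p p' * (L : ℝ) / (2 * Real.pi) + 1) / (L : ℝ) := by
      gcongr
    have hstep2 : 16 * Real.pi * C' * S * (dist p p' * (L : ℝ) / (2 * Real.pi) + 1) / (L : ℝ) =
        8 * C' * S * dist p p' + 16 * Real.pi * C' * S / (L : ℝ) := by
      field_simp
      ring
    have hstep3 : 8 * C' * S * dist p p' ≤ Z / 4 := by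
      calc 8 * C' * S * dist p p' ≤ 8 * C' * S * (2 * ε) := by gcongr
        _ = 16 * C' * S * (Z / (4 * (16 * C' * S + 1))) := by rw [hε]; ring
        _ ≤ (16 * C' * S + 1) * (Z / (4 * (16 * C' * S + 1))) := by gcongr; linarith
        _ = Z / 4 := by field_simp
    have hstep4 : 16 * Real.pi * C' * S / (L : ℝ) ≤ Z / 4 := by
      rw [div_le_iff₀ hLpos]
      have := hbigj
      rw [div_le_iff₀ hZ] at this
      linarith
    have := (le_abs_self _).trans hmain
    linarith
  -- contradiction with the jump `Z` eventually
  obtain ⟨j, hj1, hj2⟩ := (hev.and hlip).exists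
  linarith

/-! ### The bridge: `EtsTrichotomy` ⟹ the conclusion of `IncommensurateRigidity` at `(U, δ)` -/

/-- **Bridge from the filed named conjecture `EtsTrichotomy` (stmt-HubbardSuperconductivity-1458) to
the conclusion of the crux `IncommensurateRigidity` (stmt-2195) at a fixed `U > 0` and IRRATIONAL
`δ ∈ (0, 1/2)`.** Hypotheses: the trichotomy (a HYPOTHESIS — it is route AnomalyExhaustion's named
conjecture, proved nowhere); the crux's (H1) verbatim (uniform exponential clustering of `ρ₁` over all
normalised `(N_L, 0)`-sector ground states, `N_L = 2⌊(1-δ)L²/2⌋`, all large even `L`); and finite-range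
structure factors `o(L⁴)` uniformly over sector ground states (for every finite `R ⊂ ℤ²`, coefficients
`a` and `c > 0`, eventually in even `L`, `Re⟨D_q† D_q⟩_ψ ≤ c·L⁴` for all `q ≠ 0`, `D_q` the density-wave
operator of `EtsTrichotomy`/`NoDensityWave`). Conclusion: the crux's, verbatim — ONE `a > 0` with
`a·L² ≤ Re v†ρ₂(ψ)v` for some unit pair wavefunction `v`, for every sector ground state at every large
even `L`. (H3), (H4) and the variance form of (H2) are not used. Proof by contradiction: diagonal
extraction of ever-worse sector ground states along strictly increasing even sides, then the three
branches of the trichotomy are refuted by the construction (A), the structure-factor clause (B), and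
`not_fermiArc_of_clustering` (C). [folklore] -/
theorem yangODLRO_of_etsTrichotomy :
    Summit.HubbardSuperconductivity.HubbardSuperconductivity.Theses.AnomalyExhaustion.EtsTrichotomy →
    ∀ (U δ : ℝ), 0 < U → δ ∈ Set.Ioo (0 : ℝ) (1 / 2) → Irrational δ →
    (∃ C m : ℝ, 0 < m ∧ ∃ L₀ : ℕ, ∀ L ≥ L₀, Even L → ∀ Hm, Hm = hubbardTorus 2 L 1 U → ∀ ψ,
      IsGroundStateInSector Hm (2 * ⌊(1 - δ) * (L : ℝ) ^ 2 / 2⌋₊) 0 ψ → star ψ ⬝ᵥ ψ = 1 →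
      ∀ (x y : FermionTorus 2 L) (σ τ : Fin 2),
        ‖oneParticleRDM ψ (orb x σ) (orb y τ)‖ ≤
          C * Real.exp (-(m * (torusDist x.toTorusSite y.toTorusSite : ℝ)))) →
    (∀ (R : Finset (Site 2)) (a : Site 2 → Fin 2 → Fin 2 → ℂ) (c : ℝ), 0 < c →
      ∃ L₀ : ℕ, ∀ (L : ℕ) [NeZero L], L₀ ≤ L → Even L → ∀ ψ,
        IsGroundStateInSector (hubbardTorus 2 L 1 U) (2 * ⌊(1 - δ) * (L : ℝ) ^ 2 / 2⌋₊) 0 ψ →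
        star ψ ⬝ᵥ ψ = 1 → ∀ q : TorusSite 2 L, q ≠ 0 →
          (expect ((∑ x : TorusSite 2 L, torusChar q x • ∑ e ∈ R, ∑ σ : Fin 2, ∑ τ : Fin 2,
              a e σ τ • (creation (orb (FermionTorus.ofTorusSite x) σ) *
                annihilation (orb (FermionTorus.ofTorusSite (x + Torus.proj L e)) τ)))ᴴ *
            (∑ x : TorusSite 2 L, torusChar q x • ∑ e ∈ R, ∑ σ : Fin 2, ∑ τ : Fin 2,
              a e σ τ • (creation (orb (FermionTorus.ofTorusSite x) σ) *
                annihilation (orb (FermionTorus.ofTorusSite (x + Torus.proj L e)) τ)))) ψ).re ≤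
            c * (L : ℝ) ^ 4) →
    ∃ a : ℝ, 0 < a ∧ ∃ L₁ : ℕ, ∀ L ≥ L₁, Even L → ∀ Hm, Hm = hubbardTorus 2 L 1 U → ∀ ψ,
      IsGroundStateInSector Hm (2 * ⌊(1 - δ) * (L : ℝ) ^ 2 / 2⌋₊) 0 ψ → star ψ ⬝ᵥ ψ = 1 →
      ∃ v : Orb (FermionTorus 2 L) × Orb (FermionTorus 2 L) → ℂ,
        star v ⬝ᵥ v = 1 ∧ a * (L : ℝ) ^ 2 ≤ (star v ⬝ᵥ Matrix.mulVec (twoParticleRDM ψ) v).re := by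
  intro hE U δ hU hδ hirr h1 hS
  by_contra hneg
  push Not at hneg
  -- bad sector ground states are frequent along the sides `M + 1`, for every badness `1/(j+1)`
  have hfreq : ∀ j : ℕ, ∃ᶠ M in atTop, Even (M + 1) ∧
      ∃ ψ : Fock (Orb (FermionTorus 2 (M + 1))),
        IsGroundStateInSector (hubbardTorus 2 (M + 1) 1 U)
            (2 * ⌊(1 - δ) * ((M + 1 : ℕ) : ℝ) ^ 2 / 2⌋₊) 0 ψ ∧ star ψ ⬝ᵥ ψ = 1 ∧
          (twoParticleRDM ψ).supRayleigh ≤ ((M + 1 : ℕ) : ℝ) ^ 2 / ((j : ℝ) + 1) := by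
    intro j
    rw [frequently_atTop]
    intro b
    obtain ⟨L, hL, hev, Hm, rfl, ψ, hgs, hn, hbad⟩ :=
      hneg (1 / ((j : ℝ) + 1)) (by positivity) (b + 1)
    obtain ⟨M, rfl⟩ : ∃ M, L = M + 1 := ⟨L - 1, by omega⟩
    refine ⟨M, by omega, hev, ψ, hgs, hn, ?_⟩
    unfold Matrix.supRayleigh
    refine Real.iSup_le (fun v => ?_) (by positivity)
    have := hbad v.1 v.2
    rw [one_div, inv_mul_eq_div] at this
    exact this.le
  obtain ⟨φ, hφ, hQ⟩ := extraction_forall_of_frequently hfreq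
  choose ψ hψ using fun j => (hQ j).2
  -- the trichotomy for the extracted family
  have hblock : StrictMono φ ∧ ∀ j, Even (φ j + 1) ∧ star (ψ j) ⬝ᵥ ψ j = 1 ∧
      IsGroundStateInSector (hubbardTorus 2 (φ j + 1) 1 U)
        (2 * ⌊(1 - δ) * ((φ j + 1 : ℕ) : ℝ) ^ 2 / 2⌋₊) 0 (ψ j) :=
    ⟨hφ, fun j => ⟨(hQ j).1, (hψ j).2.1, (hψ j).1⟩⟩
  have hEt := hE U δ φ ψ hU hδ hirr hblock
  dsimp only at hEt
  have hside : Tendsto (fun j => φ j + 1) atTop atTop := (tendsto_add_atTop_nat 1).comp hφ.tendsto_atTop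
  rcases hEt with hA | hB | hC
  · -- (A): a pair condensate along the family, against `λ_max ≤ L²/(j+1)`
    obtain ⟨c, hc, hfr⟩ := hA
    have hev : ∀ᶠ j : ℕ in atTop, 1 / ((j : ℝ) + 1) < c :=
      (tendsto_one_div_add_atTop_nhds_zero_nat.eventually (eventually_lt_nhds hc))
    obtain ⟨j, hj, hjc⟩ := (hfr.and_eventually hev).exists
    have hbad := (hψ j).2.2
    have hL2 : (0 : ℝ) < ((φ j + 1 : ℕ) : ℝ) ^ 2 := by positivity
    have h1 : c * ((φ j + 1 : ℕ) : ℝ) ^ 2 ≤ ((φ j + 1 : ℕ) : ℝ) ^ 2 / ((j : ℝ) + 1) := hj.trans hbad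
    have h2 : ((φ j + 1 : ℕ) : ℝ) ^ 2 / ((j : ℝ) + 1) < c * ((φ j + 1 : ℕ) : ℝ) ^ 2 := by
      rw [div_eq_mul_one_div, mul_comm]
      exact mul_lt_mul_of_pos_right hjc hL2
    linarith
  · -- (B): a finite-range density wave along the family, against the structure-factor clause
    obtain ⟨R, a, c, hc, hfr⟩ := hB
    obtain ⟨L₀, hL₀⟩ := hS R a (c / 2) (by positivity)
    have hevL : ∀ᶠ j in atTop, L₀ ≤ φ j + 1 := hside.eventually_ge_atTop L₀
    obtain ⟨j, ⟨q, hq, hqB⟩, hjL⟩ := (hfr.and_eventually hevL).exists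
    have hle := hL₀ (φ j + 1) hjL (hQ j).1 (ψ j) (hψ j).1 (hψ j).2.1 q hq
    have hL4 : (0 : ℝ) < ((φ j + 1 : ℕ) : ℝ) ^ 4 := by positivity
    have hct : 0 < c * ((φ j + 1 : ℕ) : ℝ) ^ 4 := mul_pos hc hL4
    linarith [hqB.trans hle]
  · -- (C): an arc of quasiparticle discontinuities, against (H1)
    obtain ⟨C, m, hm, L₀, hcl⟩ := h1
    have hevL : ∀ᶠ j in atTop, L₀ ≤ φ j + 1 := hside.eventually_ge_atTop L₀
    refine not_fermiArc_of_clustering φ hφ ψ C m hm ?_ hC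
    filter_upwards [hevL] with j hj
    intro x y σ
    exact hcl (φ j + 1) hj (hQ j).1 _ rfl (ψ j) (hψ j).1 (hψ j).2.1 x y σ σ

/-- **The bridge with bounded structure factors** (the `R`-style clause): as
`yangODLRO_of_etsTrichotomy`, with the `o(L⁴)` clause replaced by the stronger, constant-carrying form
"for every finite `R ⊂ ℤ²` and coefficients `a` there are `C, L₀` with `Re⟨D_q† D_q⟩_ψ ≤ C·L²` for all
`q ≠ 0`, all sector ground states `ψ` and all even `L ≥ L₀`" — no Bragg peak and a bounded static
structure factor in every finite-range particle–hole channel, which is what the crux's (H2) gives for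
translation-invariant states. [folklore] -/
theorem yangODLRO_of_etsTrichotomy_of_bounded
    (hE : Summit.HubbardSuperconductivity.HubbardSuperconductivity.Theses.AnomalyExhaustion.EtsTrichotomy)
    (U δ : ℝ) (hU : 0 < U) (hδ : δ ∈ Set.Ioo (0 : ℝ) (1 / 2)) (hirr : Irrational δ)
    (h1 : ∃ C m : ℝ, 0 < m ∧ ∃ L₀ : ℕ, ∀ L ≥ L₀, Even L → ∀ Hm, Hm = hubbardTorus 2 L 1 U → ∀ ψ,
      IsGroundStateInSector Hm (2 * ⌊(1 - δ) * (L : ℝ) ^ 2 / 2⌋₊) 0 ψ → star ψ ⬝ᵥ ψ = 1 →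
      ∀ (x y : FermionTorus 2 L) (σ τ : Fin 2),
        ‖oneParticleRDM ψ (orb x σ) (orb y τ)‖ ≤
          C * Real.exp (-(m * (torusDist x.toTorusSite y.toTorusSite : ℝ))))
    (hS : ∀ (R : Finset (Site 2)) (a : Site 2 → Fin 2 → Fin 2 → ℂ),
      ∃ C : ℝ, ∃ L₀ : ℕ, ∀ (L : ℕ) [NeZero L], L₀ ≤ L → Even L → ∀ ψ,
        IsGroundStateInSector (hubbardTorus 2 L 1 U) (2 * ⌊(1 - δ) * (L : ℝ) ^ 2 / 2⌋₊) 0 ψ →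
        star ψ ⬝ᵥ ψ = 1 → ∀ q : TorusSite 2 L, q ≠ 0 →
          (expect ((∑ x : TorusSite 2 L, torusChar q x • ∑ e ∈ R, ∑ σ : Fin 2, ∑ τ : Fin 2,
              a e σ τ • (creation (orb (FermionTorus.ofTorusSite x) σ) *
                annihilation (orb (FermionTorus.ofTorusSite (x + Torus.proj L e)) τ)))ᴴ *
            (∑ x : TorusSite 2 L, torusChar q x • ∑ e ∈ R, ∑ σ : Fin 2, ∑ τ : Fin 2,
              a e σ τ • (creation (orb (FermionTorus.ofTorusSite x) σ) *
                annihilation (orb (FermionTorus.ofTorusSite (x + Torus.proj L e)) τ)))) ψ).re ≤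
            C * (L : ℝ) ^ 2) :
    ∃ a : ℝ, 0 < a ∧ ∃ L₁ : ℕ, ∀ L ≥ L₁, Even L → ∀ Hm, Hm = hubbardTorus 2 L 1 U → ∀ ψ,
      IsGroundStateInSector Hm (2 * ⌊(1 - δ) * (L : ℝ) ^ 2 / 2⌋₊) 0 ψ → star ψ ⬝ᵥ ψ = 1 →
      ∃ v : Orb (FermionTorus 2 L) × Orb (FermionTorus 2 L) → ℂ,
        star v ⬝ᵥ v = 1 ∧ a * (L : ℝ) ^ 2 ≤ (star v ⬝ᵥ Matrix.mulVec (twoParticleRDM ψ) v).re := by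
  refine yangODLRO_of_etsTrichotomy hE U δ hU hδ hirr h1 fun R a c hc => ?_
  obtain ⟨C, L₀, hC⟩ := hS R a
  -- beyond `L² ≥ C/c` the bound `C L² ≤ c L⁴` holds
  obtain ⟨L₁, hL₁⟩ := exists_nat_ge (C / c)
  refine ⟨max L₀ (max L₁ 1), fun L _ hL hev ψ hgs hn q hq => ?_⟩
  have hL0 : L₀ ≤ L := le_trans (le_max_left _ _) hL
  have hL1 : (L₁ : ℝ) ≤ (L : ℝ) := by exact_mod_cast le_trans (le_max_left _ _) (le_trans (le_max_right _ _) hL)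
  have hLone : (1 : ℝ) ≤ (L : ℝ) := by exact_mod_cast le_trans (le_max_right _ _) (le_trans (le_max_right _ _) hL)
  refine (hC L hL0 hev ψ hgs hn q hq).trans ?_
  have hCc : C ≤ c * (L : ℝ) := by
    have := hL₁.trans hL1
    rw [div_le_iff₀ hc] at this
    linarith [mul_comm (L : ℝ) c]
  calc C * (L : ℝ) ^ 2 ≤ c * (L : ℝ) * (L : ℝ) ^ 2 :=
        mul_le_mul_of_nonneg_right hCc (by positivity)
    _ = c * (L : ℝ) ^ 3 := by ring
    _ ≤ c * (L : ℝ) ^ 4 :=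
        mul_le_mul_of_nonneg_left (pow_le_pow_right₀ hLone (by norm_num)) hc.le

end Summit.HubbardSuperconductivity.IncommensurateRigidity.Birth

end
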